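import Mathlib
import HarnessLib

/-!
# The diagonal torus acting on a polynomial ring: `X_i ↦ u^{w_i} X_i`, and weighted homogeneity

Topic `Literature/RingTheory/MvPolynomial` (companion of `…MvPolynomial.WeightOperators`, the infinitesimal
version).  For a commutative ring `R`, variables `σ`, INTEGER weights `w : σ → ℤ` and a unit `u : Rˣ`, the algebra
endomorphism `torusAct w u : R[X_σ] →ₐ R[X_σ]`, `X_i ↦ u^{w_i} • X_i`, is the action of the one-parameter
diagonal torus `t ↦ diag(t^{w_i})` at `t = u`.  It is diagonal on monomials with eigenvalue `u^{weight w d}`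
(`torusAct_monomial`), so a weighted-homogeneous polynomial of weight `n` (Mathlib
`MvPolynomial.IsWeightedHomogeneous w f n`) is an eigenvector with eigenvalue `u^n` (`torusAct_of_isWeightedHomogeneous`),
and conversely over `ℂ`: if `f` is an eigenvector with eigenvalue `u^n` for every `u` on the UNIT CIRCLE, then `f` is
weighted-homogeneous of weight `n` (`isWeightedHomogeneous_of_torusAct`; distinct characters of the circle are
distinct: `int_eq_zero_of_forall_circle_zpow_eq_one`).  This is the group-level ↔ weight-level bridge used to read
torus CHARACTERS on Fock monomials (e.g. `Literature.RepresentationTheory.Ichino2022.ExplicitLine.IsHWVector`) off a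
unitary torus action.  All statements are folklore.
-/

namespace Literature.RingTheory.MvPolynomial

open _root_.MvPolynomial Finsupp
open scoped BigOperators

noncomputable section

section CommRing

variable {σ R : Type*} [CommRing R]

/-- **The diagonal torus element `u` with exponents `w`** acting on `R[X_σ]`: the `R`-algebra endomorphism
`X_i ↦ u^{w_i} • X_i`. [folklore] -/
def torusAct (w : σ → ℤ) (u : Rˣ) : MvPolynomial σ R →ₐ[R] MvPolynomial σ R :=
  aeval fun i => C ((u ^ (w i) : Rˣ) : R) * X i

/-- [folklore] -/
theorem torusAct_X (w : σ → ℤ) (u : Rˣ) (i : σ) :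
    torusAct w u (X i) = C ((u ^ (w i) : Rˣ) : R) * X i := by
  rw [torusAct, aeval_X]

/-- **Diagonal on monomials**: `torusAct w u (monomial d c) = u^{Σ_i d_i w_i} • monomial d c`, the exponent being
Mathlib's `Finsupp.weight w d`. [folklore] -/
theorem torusAct_monomial (w : σ → ℤ) (u : Rˣ) (d : σ →₀ ℕ) (c : R) :
    torusAct w u (monomial d c) = ((u ^ (weight w d) : Rˣ) : R) • monomial d c := by
  classical
  rw [torusAct, aeval_monomial]
  have h1 : (d.prod fun i k => (C ((u ^ (w i) : Rˣ) : R) * X i) ^ k) =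
      (d.prod fun i k => C (((u ^ (w i)) ^ k : Rˣ) : R)) * d.prod fun i k => (X i : MvPolynomial σ R) ^ k := by
    rw [← Finsupp.prod_mul]
    refine Finsupp.prod_congr fun i _ => ?_
    rw [mul_pow, ← map_pow, Units.val_pow_eq_pow_val]
  have h2 : (d.prod fun i k => (C (((u ^ (w i)) ^ k : Rˣ) : R) : MvPolynomial σ R)) =
      (C ((u ^ (weight w d) : Rˣ) : R) : MvPolynomial σ R) := by
    simp only [Finsupp.prod]
    rw [← map_prod C, ← Units.coe_prod]
    congr 2
    -- `∏ (u^{w i})^{d i} = u^{Σ d i • w i}` (the tree's `Kummer.prod_zpow_eq_zpow_sum`, inlined to keep imports light)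
    have hz : ∀ (t : Finset σ), ∏ i ∈ t, (u ^ w i) ^ d i = u ^ ∑ i ∈ t, (d i • w i) := by
      intro t
      induction t using Finset.induction_on with
      | empty => simp
      | insert a t ha ih =>
        rw [Finset.prod_insert ha, Finset.sum_insert ha, ih, zpow_add, ← zpow_natCast, ← zpow_mul, nsmul_eq_mul,
          mul_comm (w a), mul_comm (u ^ _)]
    rw [weight_apply, Finsupp.sum, hz]
  have h3 : (d.prod fun i k => (X i : MvPolynomial σ R) ^ k) = monomial d 1 := by
    simp only [Finsupp.prod]
    exact MvPolynomial.prod_X_pow_eq_monomial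
  rw [h1, h2, h3, MvPolynomial.algebraMap_eq, ← mul_assoc, ← map_mul, C_mul_monomial, mul_one, smul_monomial,
    smul_eq_mul, mul_comm]

/-- A weighted-homogeneous polynomial of weight `n` is an eigenvector of every torus element, eigenvalue `u^n`.
[folklore] -/
theorem torusAct_of_isWeightedHomogeneous (w : σ → ℤ) (u : Rˣ) {f : MvPolynomial σ R} {n : ℤ}
    (hf : IsWeightedHomogeneous w f n) : torusAct w u f = ((u ^ n : Rˣ) : R) • f := by
  classical
  conv_lhs => rw [f.as_sum]
  conv_rhs => rw [f.as_sum]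
  rw [map_sum, Finset.smul_sum]
  refine Finset.sum_congr rfl fun d hd => ?_
  rw [torusAct_monomial, hf (MvPolynomial.mem_support_iff.mp hd)]

/-- Coefficients of `torusAct w u f`. [folklore] -/
theorem coeff_torusAct (w : σ → ℤ) (u : Rˣ) (f : MvPolynomial σ R) (d : σ →₀ ℕ) :
    coeff d (torusAct w u f) = ((u ^ (weight w d) : Rˣ) : R) * coeff d f := by
  classical
  conv_lhs => rw [f.as_sum, map_sum]
  rw [coeff_sum]
  simp_rw [torusAct_monomial, coeff_smul, coeff_monomial, smul_eq_mul]
  rw [Finset.sum_eq_single d]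
  · rw [if_pos rfl]
  · intro b _ hb; rw [if_neg hb, mul_zero]
  · intro hd
    rw [if_pos rfl, MvPolynomial.notMem_support_iff.mp hd, mul_zero]

end CommRing

/-! ### Over `ℂ`: distinct characters of the unit circle, and the converse -/

/-- If `u ^ k = 1` for every complex number of norm one, then `k = 0` (test a primitive root of unity of order
`|k| + 1`). [folklore] -/
theorem int_eq_zero_of_forall_circle_zpow_eq_one {k : ℤ} (h : ∀ u : ℂ, ‖u‖ = 1 → u ^ k = 1) : k = 0 := by
  -- reduce to a natural exponent `m` with `u ^ m = 1` for every `u` on the circle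
  have hnat : ∀ m : ℕ, (∀ u : ℂ, ‖u‖ = 1 → u ^ m = 1) → m = 0 := by
    intro m hm
    by_contra hm0
    set n : ℕ := m + 1 with hn
    have hn0 : n ≠ 0 := Nat.succ_ne_zero _
    set ζ : ℂ := Complex.exp (2 * Real.pi * Complex.I / n) with hζ
    have hprim : IsPrimitiveRoot ζ n := Complex.isPrimitiveRoot_exp n hn0
    have hnorm : ‖ζ‖ = 1 := hprim.norm'_eq_one hn0
    have hdvd : n ∣ m := (hprim.pow_eq_one_iff_dvd m).mp (hm ζ hnorm)
    have := Nat.le_of_dvd (Nat.pos_of_ne_zero hm0) hdvd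
    omega
  obtain ⟨m, rfl | rfl⟩ := Int.eq_nat_or_neg k
  · have := hnat m (fun u hu => by have := h u hu; rwa [zpow_natCast] at this)
    simp [this]
  · have := hnat m (fun u hu => by
      have := h u hu
      rwa [zpow_neg, inv_eq_one, zpow_natCast] at this)
    simp [this]

/-- **The converse over `ℂ`**: if every torus element of the UNIT CIRCLE acts on `f` by `u^n`, then `f` is
weighted-homogeneous of weight `n`. [folklore] -/
theorem isWeightedHomogeneous_of_torusAct {σ : Type*} (w : σ → ℤ) {f : MvPolynomial σ ℂ} {n : ℤ}
    (h : ∀ (u : ℂˣ), ‖(u : ℂ)‖ = 1 → torusAct w u f = ((u ^ n : ℂˣ) : ℂ) • f) :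
    IsWeightedHomogeneous w f n := by
  classical
  intro d hd
  have key : ∀ u : ℂ, ‖u‖ = 1 → u ^ (weight w d - n) = 1 := by
    intro u hu
    have hu0 : u ≠ 0 := by intro h0; rw [h0, norm_zero] at hu; exact zero_ne_one hu
    have hc := congrArg (coeff d) (h (Units.mk0 u hu0) (by simpa using hu))
    rw [coeff_torusAct, coeff_smul, smul_eq_mul] at hc
    have hc' := mul_right_cancel₀ hd hc
    rw [Units.val_zpow_eq_zpow_val, Units.val_zpow_eq_zpow_val, Units.val_mk0] at hc'
    rw [zpow_sub₀ hu0, hc', div_self (zpow_ne_zero _ hu0)]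
  have := int_eq_zero_of_forall_circle_zpow_eq_one key
  omega

/-- **The bridge, as an `↔` over `ℂ`**: `f` is weighted-homogeneous of weight `n` iff every torus element of the
unit circle acts on it by `u^n`. [folklore] -/
theorem isWeightedHomogeneous_iff_torusAct {σ : Type*} (w : σ → ℤ) (f : MvPolynomial σ ℂ) (n : ℤ) :
    IsWeightedHomogeneous w f n ↔ ∀ (u : ℂˣ), ‖(u : ℂ)‖ = 1 → torusAct w u f = ((u ^ n : ℂˣ) : ℂ) • f :=
  ⟨fun hf u _ => torusAct_of_isWeightedHomogeneous w u hf, isWeightedHomogeneous_of_torusAct w⟩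

end

end Literature.RingTheory.MvPolynomial
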